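import Literature.MathematicalPhysics.QuantumManyBody.PeriodicConfigFourier
import Mathlib.MeasureTheory.Integral.Pi
import HarnessLib

/-!
# The tent kernel on the torus `(ℝ/ℤ)ᵈ`

Topic `Literature/MathematicalPhysics/QuantumManyBody`, namespace `BoseGas`; companion of
`TorusAutocorrelationKernel.lean`. The concrete non-negative continuous kernel
`θ_δ(t) = ∏ᵢ max(0, 1 - ‖tᵢ‖/δ)` on `UnitAddTorus d` (product of one-dimensional tents of
radius `δ` in the quotient norm `‖·‖` of `ℝ/ℤ`, `‖x mod 1‖ = |x - round x|`), used as the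
bump whose autocorrelation localises the zero Fourier mode:

* `continuous_torusTent`, `torusTent_nonneg`, `torusTent_le_one`;
* `norm_lt_of_torusTent_ne_zero` — `θ_δ(t) ≠ 0 ⇒ ‖tᵢ‖ < δ` for every coordinate;
* `integral_tentFactor_ge` (`∫_{ℝ/ℤ} max(0, 1 - ‖y‖/δ) ≥ δ/2` for `0 < δ ≤ 1`, from the Haar
  measure `min(1, 2ε)` of a closed ball of radius `ε`), `integral_torusTent_ge`
  (`∫ θ_δ ≥ (δ/2)^{card d}`), `integral_torusTent_pos`, `integral_torusTent_sq_le` (`∫θ² ≤ ∫θ`).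

No smoothness is needed downstream (only continuity, for Parseval), whence a Lipschitz tent and
not a `ContDiffBump`. Local Haar `volume` convention of `PeriodicConfigFourier.lean` / `Mathlib.Analysis.Fourier.AddCircleMulti`.

## References

* L. Grafakos, *Classical Fourier Analysis*, 3rd ed., GTM 249, Springer 2014, §3.1.1 (the torus
  `Tⁿ` and its normalised measure), §1.2.4 (approximate identities).
-/

noncomputable section

open MeasureTheory Set Filter UnitAddTorus
open scoped ENNReal

namespace Literature.MathematicalPhysics.QuantumManyBody.BoseGas

-- The measure on `ℝ/ℤ` is the Haar probability measure: the LOCAL instances of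
-- `PeriodicConfigFourier.lean` (definitionally those of `Mathlib.Analysis.Fourier.AddCircleMulti`),
-- re-activated locally; nothing is declared.
attribute [local instance] configFourier_measureSpace configFourier_isProbabilityMeasure
  configFourier_isProbabilityMeasure_pi configFourier_isAddLeftInvariant
  configFourier_isAddLeftInvariant_pi

variable {d : Type*} [Fintype d]

/-- The tent kernel is continuous. [folklore] -/
theorem continuous_torusTent (δ : ℝ) :
    Continuous fun t : UnitAddTorus d => ∏ i, max 0 (1 - ‖t i‖ / δ) := by
  fun_prop

/-- The tent kernel is non-negative. [folklore] -/
theorem torusTent_nonneg (δ : ℝ) (t : UnitAddTorus d) : 0 ≤ ∏ i, max 0 (1 - ‖t i‖ / δ) :=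
  Finset.prod_nonneg fun _ _ => le_max_left _ _

/-- The tent kernel is at most `1` (`δ > 0`). [folklore] -/
theorem torusTent_le_one {δ : ℝ} (hδ : 0 < δ) (t : UnitAddTorus d) :
    ∏ i, max 0 (1 - ‖t i‖ / δ) ≤ 1 :=
  Finset.prod_le_one (fun _ _ => le_max_left _ _) fun i _ =>
    max_le zero_le_one (by linarith [div_nonneg (norm_nonneg (t i)) hδ.le])

/-- **Support of the tent**: `θ_δ(t) ≠ 0` forces `‖tᵢ‖ < δ` in every coordinate. [folklore] -/
theorem norm_lt_of_torusTent_ne_zero {δ : ℝ} (hδ : 0 < δ) {t : UnitAddTorus d}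
    (h : ∏ j, max 0 (1 - ‖t j‖ / δ) ≠ 0) (i : d) : ‖t i‖ < δ := by
  by_contra hcon
  push Not at hcon
  apply h
  apply Finset.prod_eq_zero (Finset.mem_univ i)
  apply max_eq_left
  rw [sub_nonpos, le_div_iff₀ hδ, one_mul]
  exact hcon

/-- **The one-dimensional tent integral**: `∫_{ℝ/ℤ} max(0, 1 - ‖y‖/δ) dy ≥ δ/2` for
`0 < δ ≤ 1` (the tent is `≥ ½` on the closed ball of radius `δ/2`, of Haar measure `δ`).
[folklore] -/
theorem integral_tentFactor_ge {δ : ℝ} (hδ : 0 < δ) (hδ1 : δ ≤ 1) :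
    δ / 2 ≤ ∫ y : UnitAddCircle, max 0 (1 - ‖y‖ / δ) := by
  have hvol : (volume : Measure UnitAddCircle) (Metric.closedBall (0 : UnitAddCircle) (δ / 2)) =
      ENNReal.ofReal δ := by
    have h := AddCircle.volume_closedBall (T := 1) (x := (0 : UnitAddCircle)) (δ / 2)
    rw [AddCircle.volume_eq_smul_haarAddCircle, Measure.smul_apply, ENNReal.ofReal_one,
      one_smul] at h
    rw [show (2 : ℝ) * (δ / 2) = δ by ring, min_eq_right hδ1] at h
    exact h
  have hind : ∫ y : UnitAddCircle, (Metric.closedBall (0 : UnitAddCircle) (δ / 2)).indicator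
      (fun _ => (1 / 2 : ℝ)) y = δ / 2 := by
    rw [integral_indicator_const _ Metric.isClosed_closedBall.measurableSet, smul_eq_mul,
      Measure.real, hvol, ENNReal.toReal_ofReal hδ.le]
    ring
  rw [← hind]
  refine integral_mono ?_ ?_ fun y => ?_
  · exact (integrable_const _).indicator Metric.isClosed_closedBall.measurableSet
  · exact (Continuous.max continuous_const (by fun_prop)).integrable_of_hasCompactSupport
      (HasCompactSupport.of_compactSpace _)
  · by_cases hy : y ∈ Metric.closedBall (0 : UnitAddCircle) (δ / 2)
    · rw [indicator_of_mem hy]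
      refine le_max_of_le_right ?_
      rw [Metric.mem_closedBall, dist_zero_right] at hy
      rw [le_sub_comm, div_le_iff₀ hδ]
      linarith
    · rw [indicator_of_notMem hy]
      exact le_max_left _ _

/-- **Mass of the tent**: `∫ θ_δ ≥ (δ/2)^{card d}` for `0 < δ ≤ 1` (product integral). [folklore] -/
theorem integral_torusTent_ge {δ : ℝ} (hδ : 0 < δ) (hδ1 : δ ≤ 1) :
    (δ / 2) ^ Fintype.card d ≤ ∫ t : UnitAddTorus d, ∏ i, max 0 (1 - ‖t i‖ / δ) := by
  rw [volume_pi, integral_fintype_prod_eq_pow (ι := d) (fun y : UnitAddCircle => max 0 (1 - ‖y‖ / δ))]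
  exact pow_le_pow_left₀ (by linarith) (integral_tentFactor_ge hδ hδ1) _

/-- The tent has positive mass. [folklore] -/
theorem integral_torusTent_pos {δ : ℝ} (hδ : 0 < δ) (hδ1 : δ ≤ 1) :
    0 < ∫ t : UnitAddTorus d, ∏ i, max 0 (1 - ‖t i‖ / δ) :=
  lt_of_lt_of_le (by positivity) (integral_torusTent_ge hδ hδ1)

/-- `∫ θ_δ² ≤ ∫ θ_δ` (as `0 ≤ θ_δ ≤ 1`). [folklore] -/
theorem integral_torusTent_sq_le {δ : ℝ} (hδ : 0 < δ) :
    ∫ t : UnitAddTorus d, (∏ i, max 0 (1 - ‖t i‖ / δ)) ^ 2 ≤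
      ∫ t : UnitAddTorus d, ∏ i, max 0 (1 - ‖t i‖ / δ) := by
  refine integral_mono ?_ ?_ fun t => ?_
  · exact ((continuous_torusTent δ).pow 2).integrable_of_hasCompactSupport
      (HasCompactSupport.of_compactSpace _)
  · exact (continuous_torusTent δ).integrable_of_hasCompactSupport
      (HasCompactSupport.of_compactSpace _)
  · have h0 := torusTent_nonneg δ t
    have h1 := torusTent_le_one hδ t
    simp only
    nlinarith

end Literature.MathematicalPhysics.QuantumManyBody.BoseGas

end
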